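import Summits.QuantumFields.YangMills.Theorems.FlatTubeReductionNearFlatOfBORate
import Summits.QuantumFields.YangMills.Theorems.FlatTubeReductionNearFlatDichotomyGlue
import HarnessLib

/-!
# Route `FlatTubeReduction`: K1a′ `PinnedTubeRatioLawW` (stmt-QuantumFields-27141) is EQUIVALENT to K1 `NearFlatRatioLaw`
# (stmt-QuantumFields-24720) modulo landed glue — hence K1a′ also follows from the Born–Oppenheimer data with rate `BORateAll`
# (rung R2b1 = RECORD-label femto gap; no summit statement is proved here)

Seat `ym-line-ftr-p1` g6 (prover).  The windowed pinned-tube ratio law K1a′ has, for every `L ≥ 2`, EXACTLY the hypothesis list of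
K1 plus ONE additional (pinning) support hypothesis and one extra existential `κ ∈ (14/51, 1/3)` that does not occur in the conclusion.
Hence `NearFlatRatioLaw → PinnedTubeRatioLawW` is immediate (witness `κ := 3/10`, the pinning hypothesis is discarded), and together with
the landed dichotomy glue `nearFlatRatioLaw_of_pinnedTubeRatioLaw_window` (g3, p617122) the two items are logically equivalent:
★ `nearFlatRatioLaw_iff_pinnedTubeRatioLawW`.  Consequently everything that closes K1 closes K1a′: ★ `pinnedTubeRatioLawW_of_innerRate`
(the inner no-intruder with rate at `k = 1`, `δ = β^{-1/40}`) and ★ `pinnedTubeRatioLawW_of_boRate` (hypothesis VERBATIM the body of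
`Cruxes.FixedLatticeLaw.Rate.BORateAll` = the registered stub `stub_boRate` of cruxes 23943 and 24720), correcting the seat record
«27141 is not implied by borate» (g4/g5 memos): no pinned-∩-tube ⊂ near-region lattice geometry is needed for that implication.
HONEST FRAMING: pure glue (three `fun`/`exact` lines); the Born–Oppenheimer data with rate is OPEN fixed-lattice semiclassics; nothing
here is infinite volume, a continuum limit or the Clay mass gap.  No definitions, no named facts, no `sorry`.
References: M. Lüscher, NPB 219 (1983) 233 [cite: Luscher1983, §3]; Reed–Simon IV [cite: ReedSimonIV1978, Thm. XIII.1].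
-/

set_option autoImplicit false

noncomputable section

open MeasureTheory Real
open scoped BigOperators
open Literature.MathematicalPhysics.QuantumFieldTheory hiding SU2
open Literature.MathematicalPhysics.QuantumLattice

namespace Summit.QuantumFields.YangMills.Theorems.FlatTubeReduction

open Summit.QuantumFields.YangMills.Theses.FlatTubeReduction
open Summit.QuantumFields.YangMills.Theorems.FemtoTransferGap
open Summit.QuantumFields.YangMills.Theorems.FemtoCutoffLadder

/-- ★ **K1 ⇒ K1a′**: the windowed pinned-tube ratio law `PinnedTubeRatioLawW` (stmt-QuantumFields-27141) follows from `NearFlatRatioLaw`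
(stmt-QuantumFields-24720) by discarding the pinning hypothesis (witness `κ := 3/10 ∈ (14/51, 1/3)`). [cite: Luscher1983, §3] -/
theorem pinnedTubeRatioLawW_of_nearFlatRatioLaw (h : NearFlatRatioLaw) : PinnedTubeRatioLawW := by
  intro L _ _hL
  obtain ⟨θ, C, β0, hθ0, hθ1, hmain⟩ := h L
  refine ⟨θ, 3 / 10, C, β0, hθ0, hθ1, ⟨by norm_num, by norm_num⟩, ?_⟩
  intro β hβ Ω ψ hΩ hpos heig hψ horth htube _hpin
  exact hmain β hβ Ω ψ hΩ hpos heig hψ horth htube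

/-- ★ **K1 ⟺ K1a′** modulo landed glue: `NearFlatRatioLaw ↔ PinnedTubeRatioLawW` — forward by discarding the pinning hypothesis, backward by
the dichotomy glue `nearFlatRatioLaw_of_pinnedTubeRatioLaw_window` (near-top relocalisation + one-site law + `L = 1` ground min–max).
The two keyed items stmt-QuantumFields-24720 / 27141 are one obligation. [cite: Luscher1983, §3] [cite: ReedSimonIV1978, Thm. XIII.1] -/
theorem nearFlatRatioLaw_iff_pinnedTubeRatioLawW : NearFlatRatioLaw ↔ PinnedTubeRatioLawW :=
  ⟨pinnedTubeRatioLawW_of_nearFlatRatioLaw, fun h => nearFlatRatioLaw_of_pinnedTubeRatioLaw_window fun L _ hL => h L hL⟩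

/-- ★ **K1a′ from the INNER NO-INTRUDER WITH RATE** (`k = 1`, `δ = β^{-1/40}`, every `L ≥ 2`; = the `L`-clause of the conclusion of the
FixedLatticeLaw door `innerRateAt_of_bo_pow 1`): through K1 (`nearFlatRatioLaw_of_innerRate`). [cite: Luscher1983, §3] -/
theorem pinnedTubeRatioLawW_of_innerRate
    (hI : ∀ (L : ℕ) [NeZero L], 2 ≤ L → ∃ C βI : ℝ, ∀ β : ℝ, βI ≤ β →
      ∀ F : Fin 2 → (GaugeConfig 3 L SU2 → ℝ), (∀ i, IsPhys (F i)) →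
        (∀ i U, F i U ≠ 0 → ∃ z : Fin 3 → Bool, orbitDist (TT.twist3 z U) < powScale (1 / 40) β) →
        (∀ a : Fin 2 → ℝ, a ≠ 0 → 0 < l2 (fun U => ∑ i, a i * F i U) (fun U => ∑ i, a i * F i U)) →
          ∃ a : Fin 2 → ℝ, a ≠ 0 ∧
            qform su2Rep β (fun U => ∑ i, a i * F i U) (fun U => ∑ i, a i * F i U) * levelValue su2Rep 1 ((L : ℝ) ^ 3 * β) 0 ≤
              Real.exp (C * bareLambda ((L : ℝ) ^ 3 * β) ^ 2) * levelValue su2Rep 1 ((L : ℝ) ^ 3 * β) 1 *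
                levelValue su2Rep L β 0 * l2 (fun U => ∑ i, a i * F i U) (fun U => ∑ i, a i * F i U)) :
    PinnedTubeRatioLawW :=
  pinnedTubeRatioLawW_of_nearFlatRatioLaw (nearFlatRatioLaw_of_innerRate hI)

/-- ★ **K1a′ from the Born–Oppenheimer data with rate** — the hypothesis is VERBATIM the body of `Cruxes.FixedLatticeLaw.Rate.BORateAll`, i.e. the
statement of the registered stub `stub_boRate` of cruxes `FixedLatticeLaw` 23943 (skeleton «rate») and `NearFlatRatioLaw` 24720 (skeleton «borate»):
floor with rate + adiabatic split (P1)(P3)(P4)(P5)(P6) at `k = 1`, `δ = β^{-1/40}`, every `L ≥ 2`.  Through K1 (`nearFlatRatioLaw_of_boRate`); no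
pinned-∩-tube ⊂ near-region geometry is used. [cite: Luscher1983, §3] -/
theorem pinnedTubeRatioLawW_of_boRate
    (hBO : ∀ (L : ℕ) [NeZero L], 2 ≤ L →
      ∃ C gap βB : ℝ, 0 < gap ∧ ∀ β : ℝ, βB ≤ β →
        ∃ N : ℝ, 0 < N ∧
          N * levelValue su2Rep 1 ((L : ℝ) ^ 3 * β) 0 * Real.exp (-(C * bareLambda ((L : ℝ) ^ 3 * β) ^ 2)) ≤ levelValue su2Rep L β 0 ∧
          ∀ G : Fin 2 → (GaugeConfig 3 L SU2 → ℝ),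
            (∀ i, Measurable (G i)) → (∀ i, ∃ C' : ℝ, ∀ U, |G i U| ≤ C') →
            (∀ i (g : Site 3 L → SU2) (U : GaugeConfig 3 L SU2), G i (gaugeTransform g U) = G i U) →
            (∀ i U, G i U ≠ 0 → orbitDist U < powScale (1 / 40) β) →
            ∃ (φ : Fin 2 → (GaugeConfig 3 L SU2 → ℝ)) (g : Fin 2 → (GaugeConfig 3 1 SU2 → ℝ)),
              (∀ i, Measurable (φ i)) ∧ (∀ i, ∃ C' : ℝ, ∀ U, |φ i U| ≤ C') ∧ (∀ i, IsPhys (g i)) ∧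
              ∀ a : Fin 2 → ℝ,
                2 * |l2 (fun U => ∑ i, a i * φ i U) (fun U => ∑ i, a i * G i U - ∑ i, a i * φ i U)| ≤
                    C * bareLambda ((L : ℝ) ^ 3 * β) ^ 2 *
                      (l2 (fun U => ∑ i, a i * φ i U) (fun U => ∑ i, a i * φ i U) +
                        l2 (fun U => ∑ i, a i * G i U - ∑ i, a i * φ i U) (fun U => ∑ i, a i * G i U - ∑ i, a i * φ i U)) ∧
                qform su2Rep β (fun U => ∑ i, a i * G i U - ∑ i, a i * φ i U) (fun U => ∑ i, a i * G i U - ∑ i, a i * φ i U) ≤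
                    (1 - gap) * (N * levelValue su2Rep 1 ((L : ℝ) ^ 3 * β) 1) *
                      l2 (fun U => ∑ i, a i * G i U - ∑ i, a i * φ i U) (fun U => ∑ i, a i * G i U - ∑ i, a i * φ i U) ∧
                qform su2Rep β (fun U => ∑ i, a i * φ i U) (fun U => ∑ i, a i * G i U - ∑ i, a i * φ i U) ^ 2 ≤
                    C * bareLambda ((L : ℝ) ^ 3 * β) ^ 2 * (N * levelValue su2Rep 1 ((L : ℝ) ^ 3 * β) 1) ^ 2 *
                      (l2 (fun U => ∑ i, a i * φ i U) (fun U => ∑ i, a i * φ i U) *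
                        l2 (fun U => ∑ i, a i * G i U - ∑ i, a i * φ i U) (fun U => ∑ i, a i * G i U - ∑ i, a i * φ i U)) ∧
                qform su2Rep β (fun U => ∑ i, a i * φ i U) (fun U => ∑ i, a i * φ i U) ≤
                    Real.exp (C * bareLambda ((L : ℝ) ^ 3 * β) ^ 2) * N *
                        qform su2Rep ((L : ℝ) ^ 3 * β) (fun U => ∑ i, a i * g i U) (fun U => ∑ i, a i * g i U) +
                      C * bareLambda ((L : ℝ) ^ 3 * β) ^ 2 * (N * levelValue su2Rep 1 ((L : ℝ) ^ 3 * β) 1) *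
                        l2 (fun U => ∑ i, a i * φ i U) (fun U => ∑ i, a i * φ i U) ∧
                l2 (fun U => ∑ i, a i * g i U) (fun U => ∑ i, a i * g i U) ≤
                    Real.exp (C * bareLambda ((L : ℝ) ^ 3 * β) ^ 2) * l2 (fun U => ∑ i, a i * φ i U) (fun U => ∑ i, a i * φ i U)) :
    PinnedTubeRatioLawW :=
  pinnedTubeRatioLawW_of_nearFlatRatioLaw (nearFlatRatioLaw_of_boRate hBO)

end Summit.QuantumFields.YangMills.Theorems.FlatTubeReduction

end
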